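import Summits.KontsevichZagierPeriods.KontsevichZagierPeriods.Theorems.SoloInformedKZPOneKCharts
import HarnessLib
import HarnessLib.Audit

/-!
# SoloInformed — the interval-cells move: a reusable rule-(1) decomposition of a bounded one-dimensional representation

Solo programme `solo-KontsevichZagierPeriods-informed`, session s112, file 23 (generic tool, no
sector claim).

For a representation `r = [D, f]` of dimension `1` with BOUNDED domain, an adapted cylindrical
algebraic decomposition of the line yields finitely many open intervals `(lo i, hi i)` with
ALGEBRAIC endpoints, each contained in `D`, pairwise disjoint, covering `D` up to finitely many
points; by rule (1) (additivity over an almost-partition, `KZ.of_sub_sum_of_mem_relations`)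
`[r] − Σ_i [r|_{(lo i, hi i)}] ∈ relations` (`soloInformed_exists_intervalCells`).  This is the
decomposition step used (inlined) in files 10, 15 and 17; here it is isolated so that any class of
integrands closed under restriction can be treated interval by interval
(`soloInformed_segSpan_of_intervalwise`).

References: M. Kontsevich, D. Zagier, *Periods* (2001), §1.1 rule (1); Bochnak–Coste–Roy, *Real
algebraic geometry*, §2.3 (cylindrical decomposition).
-/

noncomputable section

open scoped BigOperators

namespace Summit.KontsevichZagierPeriods.KontsevichZagierPeriods.Theorems

open Set MeasureTheory
open Literature.ModelTheory.ExponentialFields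
open Literature.NumberTheory.Transcendental Literature.NumberTheory.Transcendental.KZ

/-- **Interval cells.** A bounded representation of dimension `1` is congruent modulo relations to
the sum of its restrictions to finitely many pairwise disjoint open intervals with algebraic
endpoints contained in its domain (the bounded bands of an adapted cylindrical decomposition; the
complement in the domain is a finite set of points). [Kontsevich–Zagier 2001, rule (1); BCR §2.3] -/
theorem soloInformed_exists_intervalCells (r : IntegralRep 1) (hb : Bornology.IsBounded r.domain) :
    ∃ (ι : Type) (_ : Fintype ι) (lo hi : ι → ℝ)
      (hS : ∀ i, IsSemialgebraic ℚ {w : Fin 1 → ℝ | ∀ k, lo i < w k ∧ w k < hi i})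
      (hD : ∀ i, {w : Fin 1 → ℝ | ∀ k, lo i < w k ∧ w k < hi i} ⊆ r.domain),
      (∀ i, lo i < hi i ∧ IsAlgebraic ℚ (lo i) ∧ IsAlgebraic ℚ (hi i)) ∧
      (Pairwise fun i j => Disjoint {w : Fin 1 → ℝ | ∀ k, lo i < w k ∧ w k < hi i}
        {w | ∀ k, lo j < w k ∧ w k < hi j}) ∧
      (r.domain \ ⋃ i, {w : Fin 1 → ℝ | ∀ k, lo i < w k ∧ w k < hi i}).Finite ∧
      of r - ∑ i, of (r.restrict _ (hS i) (hD i)) ∈ relations := by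
  classical
  -- an adapted cylindrical decomposition of the line
  obtain ⟨𝒮, hcd, hF⟩ := IsSemialgebraic.exists_cylindricalDecomposition_holds (k := ℚ)
    ({r.domain} : Finset (Set (Fin 1 → ℝ))) (by simpa using r.isSemialgebraic_domain)
  obtain ⟨𝒞, h𝒞𝒮, h𝒞K⟩ := hF r.domain (by simp)
  obtain ⟨-, hsemi, 𝒮₀, h0, hstack⟩ := isCylindricalDecomposition_succ.1 hcd
  have h0' : 𝒮₀ = {univ} := isCylindricalDecomposition_zero.1 h0
  subst h0'
  obtain ⟨l, ξ, -, hsa, hmono, hcells⟩ := hstack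
  set pt : Fin 0 → ℝ := Fin.elim0 with hpt
  set L := l univ with hL
  set ζ : Fin L → (Fin 0 → ℝ) → ℝ := ξ univ with hζ
  set c : Fin L → ℝ := fun j => ζ j pt with hc
  have hcmono : StrictMono c := hmono univ (by simp) pt (mem_univ _)
  have hinit : ∀ w : Fin 1 → ℝ, Fin.init w = pt := fun w => Subsingleton.elim _ _
  have hgraph : ∀ j : Fin L, graphOver univ (ζ j) = {fun _ => c j} := fun j => by
    ext w
    rw [mem_graphOver_iff, hinit w, mem_singleton_iff]
    simp only [mem_univ, true_and]
    constructor
    · intro h; rw [KZ.eq_const_apply_zero w]; exact congrArg (fun t => fun _ : Fin 1 => t) h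
    · intro h; rw [h]
  have halg : ∀ j : Fin L, IsAlgebraic ℚ (c j) := fun j => by
    have hmem : graphOver univ (ζ j) ∈ 𝒮 := (hcells _).2 ⟨univ, by simp, Or.inl ⟨j, rfl⟩⟩
    have hs := hsemi _ hmem
    rw [hgraph j] at hs
    exact isAlgebraic_of_mem_of_finite hs (finite_singleton _) (mem_singleton _)
  -- index set: the bands inside the (bounded) domain, necessarily interior bands
  let ι := {j : Fin (L + 1) // bandOver univ ζ j ∈ 𝒞}
  have hsubD : ∀ i : ι, bandOver univ ζ i.1 ⊆ r.domain := fun i =>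
    h𝒞K ▸ subset_sUnion_of_mem i.2
  have hne0 : ∀ i : ι, i.1 ≠ 0 := fun i h =>
    soloInformed_band_zero_not_isBounded ζ (hb.subset (h ▸ hsubD i))
  have hnel : ∀ i : ι, i.1 ≠ Fin.last L := fun i h =>
    soloInformed_band_last_not_isBounded ζ (hb.subset (h ▸ hsubD i))
  set lo : ι → ℝ := fun i => c (i.1.pred (hne0 i)) with hlo
  set hi : ι → ℝ := fun i => c (i.1.castPred (hnel i)) with hhi
  have hlohi : ∀ i, lo i < hi i := fun i => hcmono (by
    rw [Fin.lt_def, Fin.val_pred, Fin.coe_castPred]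
    have h1 : (i.1 : ℕ) ≠ 0 := fun h => hne0 i (Fin.ext h)
    omega)
  have hband : ∀ i : ι, bandOver univ ζ i.1 = {w | ∀ k, lo i < w k ∧ w k < hi i} := fun i => by
    ext w
    rw [mem_bandOver_iff, bandLower_of_ne_zero ζ i.1 (hne0 i), bandUpper_of_ne_last ζ i.1 (hnel i),
      hinit w, EReal.coe_lt_coe_iff, EReal.coe_lt_coe_iff]
    simp only [mem_univ, true_and, mem_setOf_eq]
    constructor
    · rintro h ⟨k, hk⟩
      have hk0 : k = 0 := by omega
      subst hk0
      exact h
    · intro h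
      exact h (Fin.last 0)
  have hbandS : ∀ i : ι, IsSemialgebraic ℚ {w : Fin 1 → ℝ | ∀ k, lo i < w k ∧ w k < hi i} :=
    fun i => hband i ▸ hsemi _ (h𝒞𝒮 i.2)
  have hbandD : ∀ i : ι, {w : Fin 1 → ℝ | ∀ k, lo i < w k ∧ w k < hi i} ⊆ r.domain :=
    fun i => hband i ▸ hsubD i
  -- disjointness of distinct interior bands
  have hdisj : Pairwise fun i j : ι => Disjoint {w : Fin 1 → ℝ | ∀ k, lo i < w k ∧ w k < hi i}
      {w | ∀ k, lo j < w k ∧ w k < hi j} := by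
    intro i j hij
    rw [Set.disjoint_left]
    intro w hwi hwj
    have hij' : i.1 ≠ j.1 := fun h => hij (Subtype.ext h)
    rcases lt_or_gt_of_ne hij' with hlt | hgt
    · have hle : hi i ≤ lo j := hcmono.monotone (by
        rw [Fin.le_def, Fin.val_pred, Fin.coe_castPred]; rw [Fin.lt_def] at hlt; omega)
      have h1 := (hwi 0).2
      have h2 := (hwj 0).1
      exact absurd (lt_trans h2 (lt_of_lt_of_le h1 hle)) (lt_irrefl _)
    · have hle : hi j ≤ lo i := hcmono.monotone (by
        rw [Fin.le_def, Fin.val_pred, Fin.coe_castPred]; rw [Fin.lt_def] at hgt; omega)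
      have h1 := (hwj 0).2
      have h2 := (hwi 0).1
      exact absurd (lt_trans h2 (lt_of_lt_of_le h1 hle)) (lt_irrefl _)
  -- the uncovered part of the domain consists of graph cells: finitely many points
  have hfin : (r.domain \ ⋃ i : ι, {w : Fin 1 → ℝ | ∀ k, lo i < w k ∧ w k < hi i}).Finite := by
    refine (Set.finite_range fun j : Fin L => (fun _ => c j : Fin 1 → ℝ)).subset fun w hw => ?_
    obtain ⟨hwD, hwU⟩ := hw
    have hwD' : w ∈ ⋃₀ (𝒞 : Set (Set (Fin 1 → ℝ))) := by rw [h𝒞K]; exact hwD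
    obtain ⟨T, hT𝒞, hwT⟩ := mem_sUnion.1 hwD'
    obtain ⟨S, hS, hT⟩ := (hcells T).1 (h𝒞𝒮 hT𝒞)
    rw [Finset.mem_singleton] at hS
    subst hS
    rcases hT with ⟨j, rfl⟩ | ⟨j, rfl⟩
    · rw [hgraph j, mem_singleton_iff] at hwT
      exact ⟨j, hwT.symm⟩
    · refine (hwU ?_).elim
      refine mem_iUnion.2 ⟨⟨j, hT𝒞⟩, ?_⟩
      show w ∈ {w : Fin 1 → ℝ | ∀ k, lo ⟨j, hT𝒞⟩ < w k ∧ w k < hi ⟨j, hT𝒞⟩}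
      rw [← hband ⟨j, hT𝒞⟩]
      exact hwT
  refine ⟨ι, inferInstance, lo, hi, hbandS, hbandD, fun i => ⟨hlohi i, halg _, halg _⟩, hdisj,
    hfin, ?_⟩
  -- rule (1) over the almost-partition of the domain by the bands
  refine KZ.of_sub_sum_of_mem_relations Finset.univ r _ (fun i _ => ?_) (fun i _ _ _ => rfl) ?_ ?_
  · rw [show (r.restrict _ (hbandS i) (hbandD i)).domain \ r.domain = ∅ from
      Set.eq_empty_of_subset_empty fun w hw => hw.2 (hbandD i hw.1), measure_empty]
  · refine measure_mono_null ?_ (hfin.measure_zero volume)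
    intro w hw
    refine ⟨hw.1, fun h => hw.2 ?_⟩
    obtain ⟨i, hi⟩ := mem_iUnion.1 h
    exact mem_iUnion₂.2 ⟨i, Finset.mem_univ _, hi⟩
  · intro i _ j _ hij
    show volume ({w : Fin 1 → ℝ | ∀ k, lo i < w k ∧ w k < hi i} ∩
      {w | ∀ k, lo j < w k ∧ w k < hi j}) = 0
    rw [(hdisj hij).inter_eq]; exact measure_empty

/-- **Interval by interval.** If every restriction of a bounded representation `r` of dimension `1`
to an open interval with algebraic endpoints inside its domain lies in the span of points and
segments, then so does `r`. -/
theorem soloInformed_segSpan_of_intervalwise (r : IntegralRep 1) (hb : Bornology.IsBounded r.domain)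
    (h : ∀ (u v : ℝ), u < v → IsAlgebraic ℚ u → IsAlgebraic ℚ v →
      ∀ (hS : IsSemialgebraic ℚ {w : Fin 1 → ℝ | ∀ k, u < w k ∧ w k < v})
        (hD : {w : Fin 1 → ℝ | ∀ k, u < w k ∧ w k < v} ⊆ r.domain),
        of (r.restrict _ hS hD) ∈ soloInformedSegSpan) :
    of r ∈ soloInformedSegSpan := by
  obtain ⟨ι, _, lo, hi, hS, hD, hlh, -, -, hrel⟩ := soloInformed_exists_intervalCells r hb
  exact soloInformed_mem_segSpan_of_sub_mem hrel (soloInformed_sum_mem_segSpan _ fun i _ =>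
    h (lo i) (hi i) (hlh i).1 (hlh i).2.1 (hlh i).2.2 (hS i) (hD i))

/-- **Interval by interval, any domain.** If, for every chart piece `R` of `r` (bounded, see
`soloInformed_exists_chartReps`) every interval restriction lies in the span, then `r` lies in the
span.  Phrased with an arbitrary predicate `C` on representations of dimension `1` that is stable
under the two chart maps and implies span membership of interval restrictions of bounded
representations. -/
theorem soloInformed_segSpan_of_chartwise (C : IntegralRep 1 → Prop)
    (hchart : ∀ (r : IntegralRep 1), C r → ∀ (T : Finset (Fin 1)) (R : IntegralRep 1),
      R.domain = PeriodCompactify.pieceDom T r.domain →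
      (R.integrand = fun v => r.integrand (PeriodCompactify.inv T v) *
        |(PeriodCompactify.invDeriv T v).det|) → C R)
    (hint : ∀ (R : IntegralRep 1), C R → Bornology.IsBounded R.domain →
      ∀ (u v : ℝ), u < v → IsAlgebraic ℚ u → IsAlgebraic ℚ v →
      ∀ (hS : IsSemialgebraic ℚ {w : Fin 1 → ℝ | ∀ k, u < w k ∧ w k < v})
        (hD : {w : Fin 1 → ℝ | ∀ k, u < w k ∧ w k < v} ⊆ R.domain),
        of (R.restrict _ hS hD) ∈ soloInformedSegSpan)
    (r : IntegralRep 1) (hr : C r) : of r ∈ soloInformedSegSpan := by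
  obtain ⟨R, hR, hrel⟩ := soloInformed_exists_chartReps r
  refine soloInformed_mem_segSpan_of_sub_mem hrel (soloInformed_sum_mem_segSpan _ fun T _ => ?_)
  have hC : C (R T) := hchart r hr T (R T) (hR T).1 (hR T).2.1
  exact soloInformed_segSpan_of_intervalwise (R T) (hR T).2.2 (hint (R T) hC (hR T).2.2)

end Summit.KontsevichZagierPeriods.KontsevichZagierPeriods.Theorems
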